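import Summits.QuantumFields.YangMills.Theorems.UV3BranchExpansionHTopSegment
import Summits.QuantumFields.YangMills.Theorems.UV3BranchExpansionHaarBallSharp
import Summits.QuantumFields.YangMills.Theorems.UV3BranchExpansionCountingSmallnessT3
import Summits.QuantumFields.YangMills.Theorems.UV3PinnedStepOrganOfTopPartialIterates
import HarnessLib

/-!
# `UV3BranchExpansionHTopT3L3` — hTop FOR EVERY THREE-TORUS FAMILY WITH BLOCK SIZE `L = 3`: the `K`-fold push-forward of product Haar through
# the pinned block averaging `avT3` is dominated by `e^{c} •` coarse product Haar with ONE `c` for all `K` and all segments — the top-level kinematic row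
# of crux `UnitScaleTilt.HistoryTailL` (stmt-QuantumFields-19936) DISCHARGED at `L = 3` by LEAD ★w1's branch (Möbius) expansion spine (SUPPLY side)

Cell `ym3-torus` (YM ladder rung R3 = continuum SU(2) Yang–Mills on T³ — a RUNG, NOT d = 4, NOT infinite volume, NOT a mass gap, NOT Clay);
width seat `ym-ust-19936-w5` (gen 19), explicit-unit helper; `--supports stmt-QuantumFields-19936 --as helper`.  THEOREMS ONLY (0 `def`,
0 `sorry`, default heartbeats).

WHAT.  The row hTop(F) — `∃ c ≥ 0, ∀ K j n, j + n = K → (dU_j^{(K)})∘(iterFrom (avT3 F K) j n)⁻¹ ≤ e^{c}·dU_{j+n}^{(K)}` — is the displayed top-level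
kinematic hypothesis of ✓`UnitScaleTiltHistoryTailOfPackageTopPartialIterates.hlfLin_of_topHaarPushforward` (w3 g19), of LEAD g11's K-23∕K-24 faces and
of the g18 ♭-faces; the branch expansion spine `Cruxes/HistoryTailL/HTopBranchExpansion.md` (LEAD w1 g12) was built to supply it.  Its knit for one
segment on `SU(2)` with print's exp-mean-log average is px8 g13's ✓`UV3BranchExpansionHTopSegment.map_iterFrom_le_exp_smul_su2` (hypotheses: standing
range, `L^{d−1} ≤ 9`, `h(δ′) ≠ 0`, and the two smallness rows of the count at `x := 2·W.toReal`, `W = K⋆·h(1∕3+δ′)^{L^{d−1}−1}∕h(δ′)`); the numerics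
that close those rows at `L = 3` are px13 g14's ✓`UV3BranchExpansionHaarBallSharp.two_mul_kstar_mul_ratio_le` (`2W ≤ 3·10⁻⁵` at `δ′ = 1/21`, sharp
ball bound) and ✓`UV3BranchExpansionCountingSmallnessT3.smallness_T3_of_ennreal_le` (both rows at `(y, θ₀) = (9/10, 17/20)` for `x ≤ 3·10⁻⁵`, ★★OWNER
WORD 96 (1)).  THIS FILE plugs them in for a three-torus family `F` with `F.L = 3`:

* §1 ★ `card_pBond_top` (`#PBond(F.P K, K) = 3·(2·L^m)³`, `K`-free; `h(1/21) ≠ 0` is px13's ✓`haarData_dist1_lt_one_div_ne_zero`).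
* §2 ★★★ `map_iterFrom_blockAvg_le_exp_smul_L3` — for every `K` and every segment `j + n ≤ m + K`:
  `(dU_j).map (iterFrom (blockAvg ℰp) j n) ≤ ofReal (exp (#PBond(F.P K, j+n) · C₃)) • dU_{j+n}`, `C₃ := (2/(1−17/20))·((3/100000)/(9/10)^10)` — NO hypothesis but `F.L = 3`.
* §3 ★★★★ **`topBlockAvgPushforward_of_L_eq_three`** and ★★★★ **`topHaarPushforward_of_L_eq_three (F : T3Family) (hL3 : F.L = 3) : ⟨hTop(F) verbatim⟩`** with
  `c := 3·(2·3^{F.m})³·C₃` — the hTop row of the 19936 faces, PROVED for every three-torus family of block size 3 (over ✓`iterFrom_avT3_eq_iterFrom_blockAvg`).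

HYP-SAT (★★OWNER RULING №42).  The conclusion carries NO hypothesis except `F.L = 3`; every input letter is discharged by name on the literal families:
(H_K) by ✓`fibre_law_le_su2` inside ✓`hw_su2_of_pow_le_nine` (range `L^{d−1} ≤ 9` ⟺ `L = 3` at `d = 3`), the admitting bound and the ball bounds by
✓`two_mul_kstar_mul_ratio_le`, the smallness rows by ✓`smallness_T3_of_ennreal_le`.  `L = 5` (✓`hw_su2_of_pow_le_twentyfive` + a `K⋆⋆` numeral) and `L ≥ 7`
(record constant + tree ball bounds) are the two follow-up editions for the unrestricted `∀ F` letter — NOT here.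

HONEST SCOPE.  hTop is SUPPLY for NODE O B3 ∕ Track A's N08 (★★OWNER WORDS 84 (2) ∕ 85 (4)), NOT a row of the 19936 registry v6 {EX, (O‴χₛ)}; nothing of the χ (α)
record `AlphaInputsT3ACv4RecChi`, (O‴χₛ), EX, `HistoryTailL`, the rung R3 is proved by it; with it the g18 ♭-faces ∕ K-23 faces still display `hpkg`, `π`, `hMain`.
The Yang–Mills mass gap is NOT proved.

References: T. Bałaban, CMP **109** (1987) 249–301 [Balaban1987RG1] ((0.4) p. 253); T. Bałaban, CMP **102** (1985) 255–275 [Balaban1985UV3] ((2) p. 256,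
(5) p. 257, (41) p. 266); LEAD note `Cruxes/HistoryTailL/HTopBranchExpansion.md` v1.2 §0–§6; px13 g14 evidence #60 (numerics).
-/

set_option autoImplicit false

noncomputable section

namespace Summit.QuantumFields.YangMills.Theorems.UV3BranchExpansionHTopT3L3

open MeasureTheory
open scoped ENNReal
open Literature.MathematicalPhysics.QuantumFieldTheory (haarProbability)
open Literature.MathematicalPhysics.QuantumFieldTheory.Balaban1983to89
open Literature.MathematicalPhysics.QuantumFieldTheory.Balaban1983to89.T3ContinuumYM3Torus
open Literature.MathematicalPhysics.QuantumFieldTheory.Balaban1983to89.T3UnitLawDensityEML (ℰp)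
open Literature.MathematicalPhysics.QuantumFieldTheory.Balaban1983to89.T4CubeChartGnomonic (SU2)
open Literature.MathematicalPhysics.QuantumFieldTheory.Balaban1983to89.BlockAveraging (blockAvg)
open Literature.MathematicalPhysics.QuantumFieldTheory.Balaban1983to89.T4AvgSensitivity (iterFrom)
open Summit.QuantumFields.YangMills.BalabanUVNodes.N08HaarCompatibilityGuardHaarBall (haarData_haar_eq)
open Summit.QuantumFields.YangMills.Theorems.UV3BranchExpansionHTopSegment (map_iterFrom_le_exp_smul_su2)
open Summit.QuantumFields.YangMills.Theorems.UV3BranchExpansionHaarBallSharp (two_mul_kstar_mul_ratio_le haarData_dist1_lt_one_div_ne_zero)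
open Summit.QuantumFields.YangMills.Theorems.UV3BranchExpansionCountingSmallnessT3 (smallness_T3_of_ennreal_le)
open Summit.QuantumFields.YangMills.Theorems.UV3PinnedStepOrganOfTopPartialIterates (iterFrom_avT3_eq_iterFrom_blockAvg)

/-! ## §1 The unit-lattice bond count of a three-torus family -/

/-- ★ **THE UNIT-LATTICE BOND COUNT IS `K`-FREE**: `#PBond(F.P K, K) = (2·L^m)³ · 3` for every `K` (the `K`-th approximation's top torus has `2L^m` sites per
direction whatever `K` is). [cite: Balaban1985UV3, (1) p.256] -/
theorem card_pBond_top (F : T3Family) (K : ℕ) : Fintype.card (PBond (F.P K) K) = (2 * F.L ^ F.m) ^ 3 * 3 := by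
  -- `#PBond(P, k) = N_k^d · d` (a bond is (initial site, direction); lit `Site.card_site`; the count is lit `T4StabilityFloor.card_pbond`,
  -- re-derived in one line to keep the T⁴ stability chain out of the imports)
  rw [Fintype.card_congr (⟨fun b => (b.src, b.dir), fun p => ⟨p.1, p.2⟩, fun _ => rfl, fun _ => rfl⟩ :
    PBond (F.P K) K ≃ Site (F.P K) K × Fin (F.P K).d), Fintype.card_prod, Site.card_site, Fintype.card_fin]
  have hs : (F.P K).sitesPerDir K = 2 * F.L ^ F.m := by
    show 2 * F.L ^ (F.m + K - K) = 2 * F.L ^ F.m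
    rw [Nat.add_sub_cancel]
  rw [hs]
  rfl

/-! ## §2 One segment of a three-torus family with `L = 3`: no hypothesis but the range -/

/-- ★★★ **hTop FOR ONE SEGMENT OF A THREE-TORUS FAMILY WITH `L = 3`, HYPOTHESIS-FREE.**  For `F : T3Family` with `F.L = 3`, every `K`, every segment
`j + n ≤ m + K`: `(dU_j).map (iterFrom (blockAvg ℰp) j n) ≤ ofReal (exp (#PBond(F.P K, j+n) · (2/(1−17/20)) · ((3/100000)/(9/10)^10))) • dU_{j+n}` —
px8's ✓`map_iterFrom_le_exp_smul_su2` at `δ′ := 1/21`, `(y, θ₀) := (9/10, 17/20)`, its activity `2W ≤ 3·10⁻⁵` by px13's ✓`two_mul_kstar_mul_ratio_le` and its two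
smallness rows by ✓`smallness_T3_of_ennreal_le`, then monotonicity of the exponent in `x ≤ 3·10⁻⁵`. [cite: Balaban1987RG1, (0.4) p.253; Balaban1985UV3, (2) p.256] -/
theorem map_iterFrom_blockAvg_le_exp_smul_L3 (F : T3Family) (hL3 : F.L = 3) (K j n : ℕ) (hjn : j + n ≤ F.m + K) :
    (fieldMeasure (F.P K) j (Matrix.specialUnitaryGroup (Fin 2) ℂ)).map
        (iterFrom (fun i => blockAvg (P := F.P K) (G := Matrix.specialUnitaryGroup (Fin 2) ℂ) (j := i) ℰp) j n) ≤
      ENNReal.ofReal (Real.exp (Fintype.card (PBond (F.P K) (j + n)) * (2 / (1 - 17 / 20) * (3 / 100000 / (9 / 10) ^ 10)))) •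
        fieldMeasure (F.P K) (j + n) (Matrix.specialUnitaryGroup (Fin 2) ℂ) := by
  have hd : (F.P K).d = 3 := rfl
  have hPL : (F.P K).L = 3 := hL3
  have h8 : (F.P K).L ^ ((F.P K).d - 1) - 1 = 8 := by rw [hPL, hd]; norm_num
  have hL9 : (F.P K).L ^ ((F.P K).d - 1) ≤ 9 := by rw [hPL, hd]; norm_num
  have hjn' : j + n ≤ (F.P K).m + (F.P K).K := hjn
  -- the activity `W` at `δ′ = 1/21` and its bound
  set W : ℝ≥0∞ :=
    ((ENNReal.ofReal (((1 / 9 : ℝ) * Real.sin 1 * (Real.sin (Real.pi / 3) / (Real.pi / 3))) ^ 3 * (Real.sin (Real.pi / 3) / (Real.pi / 3)) ^ 2))⁻¹ + 1) *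
      ((HaarData.haar : Measure (Matrix.specialUnitaryGroup (Fin 2) ℂ)) {g | dist1 g < 1 / 3 + 1 / 21} ^ ((F.P K).L ^ ((F.P K).d - 1) - 1) /
        (HaarData.haar : Measure (Matrix.specialUnitaryGroup (Fin 2) ℂ)) {g | dist1 g < 1 / 21}) with hW
  have hW2 : 2 * W ≤ ENNReal.ofReal (3 / 100000) := by
    rw [hW, h8, haarData_haar_eq]
    exact two_mul_kstar_mul_ratio_le
  have hWtop : W ≠ ⊤ := by
    intro h
    rw [h, ENNReal.mul_top (by norm_num)] at hW2
    exact absurd hW2 (by simp)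
  have h2W : (2 * W).toReal = 2 * W.toReal := by
    rw [ENNReal.toReal_mul]; norm_num
  have hxle : 2 * W.toReal ≤ 3 / 100000 := by
    rw [← h2W]; exact ENNReal.toReal_le_of_le_ofReal (by norm_num) hW2
  have hx0 : 0 ≤ 2 * W.toReal := by positivity
  -- the two smallness rows at `x := 2·W.toReal`
  obtain ⟨-, hE, hG⟩ := smallness_T3_of_ennreal_le hW2
  rw [h2W] at hE hG
  -- px8's segment knit at `δ′ = 1/21`, `(y, θ₀) = (9/10, 17/20)`
  have hseg := map_iterFrom_le_exp_smul_su2 (P := F.P K) j n hjn' hL9 (1 / 21) haarData_dist1_lt_one_div_ne_zero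
    (y := 9 / 10) (θ₀ := 17 / 20) (by norm_num) (by norm_num) (by norm_num)
    (by rw [← hW, hd, hPL]; exact hE) (by rw [← hW, hd, hPL]; exact hG)
  rw [← hW, hd, hPL] at hseg
  -- monotonicity of the exponent in `x ≤ 3·10⁻⁵`
  refine hseg.trans (Measure.le_iff.2 fun B _ => ?_)
  rw [Measure.smul_apply, Measure.smul_apply, smul_eq_mul, smul_eq_mul]
  refine mul_le_mul' (ENNReal.ofReal_le_ofReal (Real.exp_le_exp.mpr ?_)) le_rfl
  refine mul_le_mul_of_nonneg_left ?_ (Nat.cast_nonneg _)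
  have h910 : ((9 : ℝ) / 10) ^ ((2 * 3 - 1) * (3 - 1)) = (9 / 10) ^ 10 := by norm_num
  rw [h910]
  have : 2 * W.toReal / (9 / 10 : ℝ) ^ 10 ≤ 3 / 100000 / (9 / 10) ^ 10 :=
    div_le_div_of_nonneg_right hxle (by positivity)
  nlinarith [this]

/-! ## §3 The hTop row of the 19936 faces, for every three-torus family with `L = 3` -/

/-- ★★★★ **THE TOP BLOCK-AVERAGING PUSH-FORWARD ROW AT `L = 3`**: for `F : T3Family` with `F.L = 3` there is ONE `c ≥ 0` (namely
`c = 3·(2·3^{m})³ · (2/(1−17/20))·((3/100000)/(9/10)^10)`) such that for every `K` and every segment `j + n = K`: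
`(dU_j).map (iterFrom (blockAvg ℰp) j n) ≤ ofReal (exp c) • dU_{j+n}` — the `hTopB` letter of ✓`topHaarPushforward_of_topBlockAvgPushforward`. The constant is
`K`-free because the unit torus of the `K`-th approximation has `3·(2L^m)³` bonds for every `K` (§1). [cite: Balaban1985UV3, (2) p.256, (5) p.257; Balaban1987RG1, (0.4) p.253] -/
theorem topBlockAvgPushforward_of_L_eq_three (F : T3Family) (hL3 : F.L = 3) :
    ∃ c : ℝ, 0 ≤ c ∧ ∀ (K j n : ℕ), j + n = K →
      (fieldMeasure (F.P K) j (Matrix.specialUnitaryGroup (Fin 2) ℂ)).map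
          (iterFrom (fun i => blockAvg (P := F.P K) (G := Matrix.specialUnitaryGroup (Fin 2) ℂ) (j := i) ℰp) j n) ≤
        ENNReal.ofReal (Real.exp c) • fieldMeasure (F.P K) (j + n) (Matrix.specialUnitaryGroup (Fin 2) ℂ) := by
  refine ⟨((2 * 3 ^ F.m) ^ 3 * 3 : ℕ) * (2 / (1 - 17 / 20) * (3 / 100000 / (9 / 10) ^ 10)), by positivity, fun K j n hK => ?_⟩
  have h := map_iterFrom_blockAvg_le_exp_smul_L3 F hL3 K j n (by omega)
  have hcard : Fintype.card (PBond (F.P K) (j + n)) = (2 * 3 ^ F.m) ^ 3 * 3 := by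
    rw [hK, card_pBond_top, hL3]
  rw [hcard] at h
  exact h

/-- ★★★★ **hTop FOR EVERY THREE-TORUS FAMILY WITH BLOCK SIZE 3** — the displayed top-level kinematic row of
✓`UnitScaleTiltHistoryTailOfPackageTopPartialIterates.hlfLin_of_topHaarPushforward` ∕ `…unitEnvelopeLin_of_topHaarPushforward_of_main` (w3 g19), of LEAD g11's
K-23∕K-24 faces and of the g18 ♭-faces, VERBATIM, PROVED at `F.L = 3`:
`∃ c ≥ 0, ∀ K j n, j + n = K → (dU_j^{(K)}).map (iterFrom (avT3 F K) j n) ≤ ofReal (exp c) • dU_{j+n}^{(K)}` (the pinned family `avT3` IS `blockAvg ℰp` in the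
range, ✓`iterFrom_avT3_eq_iterFrom_blockAvg`).  hTop is SUPPLY (NODE O ∕ N08), not a registry row; nothing of `HistoryTailL` is closed by it alone.
[cite: Balaban1985UV3, (2) p.256, (5) p.257, (41) p.266; Balaban1987RG1, (0.4) p.253] -/
theorem topHaarPushforward_of_L_eq_three (F : T3Family) (hL3 : F.L = 3) :
    ∃ c : ℝ, 0 ≤ c ∧ ∀ (K j n : ℕ), j + n = K →
      (fieldMeasure (F.P K) j (Matrix.specialUnitaryGroup (Fin 2) ℂ)).map (iterFrom (avT3 F K) j n) ≤
        ENNReal.ofReal (Real.exp c) • fieldMeasure (F.P K) (j + n) (Matrix.specialUnitaryGroup (Fin 2) ℂ) := by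
  obtain ⟨c, hc0, hc⟩ := topBlockAvgPushforward_of_L_eq_three F hL3
  refine ⟨c, hc0, fun K j n hjn => ?_⟩
  rw [iterFrom_avT3_eq_iterFrom_blockAvg F K j n (by omega)]
  exact hc K j n hjn

end Summit.QuantumFields.YangMills.Theorems.UV3BranchExpansionHTopT3L3

end
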